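import Literature.NumberTheory.IwasawaTheory.Greenberg2006.CorankEulerCharacteristicInduction
import Literature.NumberTheory.GaloisCohomology.TateGlobalEulerCharacteristicReadings
import HarnessLib

/-!
# Greenberg 2006, Prop. 4.1 — the GLOBAL Euler–Poincaré `Λ`-corank formula from Tate's global
# Euler characteristic (Milne I Thm. 5.1): the assembly at `Γ = G_{K,S}`, modulo the one-prime step

Topic `NumberTheory/IwasawaTheory/Greenberg2006`; namespace
`Literature.NumberTheory.IwasawaTheory.Greenberg2006`.  THEOREMS ONLY (no definition, no named
fact, no `sorry`, no instance).

Greenberg, *On the structure of certain Galois cohomology groups*, Prop. 4.1 (p. 367 L40 – p. 368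
L1): "`Σ_{i=0}^{2} (−1)^i corank_Λ(Hⁱ(K_Σ/K, 𝒟)) = −δ_Λ(K, 𝒟)` where `δ_Λ(K, 𝒟) = r₂m + Σ_{v real}
m_v^−`" — typed in the tree (`prop41_globalEulerPoincareCorank`) for `K` totally imaginary
(`δ = r₂·m`).  Print's proof (p. 368): specialisation to Krull dimension `1`, then to finite `𝒟`,
where the formula is Tate's.  In the tree this is the induction shell
`corankEuler_of_step_of_finiteEuler` (`CorankEulerCharacteristicInduction.lean`) instantiated at
`Γ = G_{K,S} = GaloisGroupUnramifiedOutside K S`, `c = r₂ = nrComplexPlaces K`, with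

* (E) = Tate's global Euler characteristic over a totally imaginary `K`
  (`GaloisCohomology.natCard_H_euler_of_forall_isComplex`, from the named fact
  `tateGlobalEulerPoincareCharacteristic K`, Milne I Thm. 5.1);
* (F) = finiteness of `Hⁿ(G_{K,S}, A)` for finite `A` killed by `p`
  (`GaloisCohomology.finite_continuousCohomology_of_prime`, from the named fact
  `finite_restrictedCohomology K`, Harari Cor. 17.17 = NSW (8.3.20));
* (S) = the one-prime specialisation step at `G_{K,S}` — HERE A HYPOTHESIS `hstep` (the
  cohomological engine; its own inputs at `G_{K,S}` are (F), `cd_p(G_{K,S}) ≤ 2` for `K` totally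
  imaginary — the tree's `subsingleton_H_of_two_lt_of_poitouTate_at`, Harari Thm. 17.13 (a) — and
  the ring facts of `Λ ≅ ℤ_p⟦T₁,…,T_m⟧`).

Main theorem: **`prop41_of_step_of_tateGlobalEulerPoincareCharacteristic`** —
`hstep (at every K, S, p)` → `(∀ K, tateGlobalEulerPoincareCharacteristic K)` →
`(∀ K, finite_restrictedCohomology K)` → `prop41_globalEulerPoincareCorank`.

## References
* R. Greenberg, *On the structure of certain Galois cohomology groups*, Doc. Math. Extra Vol.
  Coates (2006) 335–391, §4 A Prop. 4.1 (p. 367 L40 – p. 368 L1) and its proof (p. 368).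
  [Greenberg2006]
* J. S. Milne, *Arithmetic Duality Theorems*, 2nd ed. (2006), I Thm. 5.1 (p. 67), I Cor. 4.15.
  [MilneADT2006]
* D. Harari, *Galois Cohomology and Class Field Theory* (2020), Thm. 17.13, Cor. 17.17. [Harari2020]
-/

noncomputable section

open scoped Classical
open NumberField IsDedekindDomain Field
open Literature.NumberTheory.GaloisRepresentations
open Literature.NumberTheory.GaloisCohomology
open Literature.NumberTheory.IwasawaTheory.Greenberg2016

namespace Literature.NumberTheory.IwasawaTheory.Greenberg2006

/-- **Greenberg 2006, Prop. 4.1 at its binders, from Tate's global Euler characteristic, Poitou–Tate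
finiteness and the one-prime specialisation step at `G_{K,S}`.**  The step `hstep` is the
hypothesis schema `hstep` of `corankEuler_of_step_of_finiteEuler` for the group
`Γ = GaloisGroupUnramifiedOutside K S` (every number field `K` with all infinite places complex,
every finite `S ⊇ {v ∣ p}`); (F) and (E) are discharged from the named facts
`finite_restrictedCohomology` and `tateGlobalEulerPoincareCharacteristic`.
[cite: Greenberg2006, Prop. 4.1 (§4 A, p. 367 L40 – p. 368 L1) and its proof (p. 368)]
[cite: MilneADT2006, I Thm. 5.1 (p. 67)] -/
theorem prop41_of_step_of_tateGlobalEulerPoincareCharacteristic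
    (hstep : ∀ (p : ℕ) [Fact p.Prime] (K : Type) [Field K] [NumberField K]
      (S : Set (HeightOneSpectrum (𝓞 K))), S.Finite →
      (∀ v : HeightOneSpectrum (𝓞 K), ((p : ℕ) : 𝓞 K) ∈ v.asIdeal → v ∈ S) →
      (∀ w : InfinitePlace K, w.IsComplex) →
      ∀ (j : ℕ) (Λ : Type) [CommRing Λ] [TopologicalSpace Λ] [IsTopologicalRing Λ],
      (Λ ≃+* MvPowerSeries (Fin j) ℤ_[p]) → ∀ (T : Λ), T ≠ 0 → Prime T →
      ∀ (D : Type) [AddCommGroup D] [Module Λ D] [TopologicalSpace D] [DiscreteTopology D]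
        [ContinuousSMul Λ D] (ρ : ContinuousRep (GaloisGroupUnramifiedOutside K S) Λ D),
        (∀ d : D, ∃ n : ℕ, (p ^ n : ℤ) • d = 0) → Module.Finite Λ (CharacterModule D) →
        ∃ (D' : Type) (_ : AddCommGroup D') (_ : Module (Λ ⧸ Ideal.span {T}) D')
          (_ : TopologicalSpace D') (_ : DiscreteTopology D')
          (_ : ContinuousSMul (Λ ⧸ Ideal.span {T}) D')
          (ρ' : ContinuousRep (GaloisGroupUnramifiedOutside K S) (Λ ⧸ Ideal.span {T}) D'),
          (∀ d : D', ∃ n : ℕ, (p ^ n : ℤ) • d = 0) ∧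
          Module.Finite (Λ ⧸ Ideal.span {T}) (CharacterModule D') ∧
          ((Module.finrank Λ (CharacterModule (ρ.H 0)) : ℤ) -
              Module.finrank Λ (CharacterModule (ρ.H 1)) +
              Module.finrank Λ (CharacterModule (ρ.H 2)) =
            (Module.finrank (Λ ⧸ Ideal.span {T}) (CharacterModule (ρ'.H 0)) : ℤ) -
              Module.finrank (Λ ⧸ Ideal.span {T}) (CharacterModule (ρ'.H 1)) +
              Module.finrank (Λ ⧸ Ideal.span {T}) (CharacterModule (ρ'.H 2))) ∧
          Module.finrank Λ (CharacterModule D) =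
            Module.finrank (Λ ⧸ Ideal.span {T}) (CharacterModule D'))
    (hT : ∀ (K : Type) [Field K] [NumberField K], tateGlobalEulerPoincareCharacteristic K)
    (hPT : ∀ (K : Type) [Field K] [NumberField K], finite_restrictedCohomology K) :
    prop41_globalEulerPoincareCorank := by
  intro p _ K _ _ S hSf hSp hK Λ _ _ _ mΛ hΛ D _ _ _ _ _ ρ hpD hD m h₀ h₁ h₂ hm hh₀ hh₁ hh₂
  have key := corankEuler_of_step_of_finiteEuler (Γ := GaloisGroupUnramifiedOutside K S) p
    (InfinitePlace.nrComplexPlaces K) (hstep p K S hSf hSp hK)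
    (fun R _ _ A _ _ _ _ _ _ τ hp n => finite_continuousCohomology_of_prime S τ (hPT K) hSf p hSp hp n)
    (fun R _ _ A _ _ _ _ _ _ τ hp =>
      natCard_H_euler_of_forall_isComplex S τ (hT K) hK hSf p hSp hp)
    hΛ ρ hpD hD hm hh₀ hh₁ hh₂
  rw [key, mul_comm]

end Literature.NumberTheory.IwasawaTheory.Greenberg2006

end
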